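import Mathlib
import Summits.ResolutionOfSingularities.ResolutionOfSingularities.Theorems.HomologicalConductorPersistenceConductorCeiling
import Summits.ResolutionOfSingularities.ResolutionOfSingularities.Theorems.HomologicalConductorPersistenceDualSyzygyLevel
import HarnessLib

/-!
# Rung S-2 `PersistenceSurface` (stmt-ResolutionOfSingularities-19970) — the CONDUCTOR CEILING AT HIGHER LEVELS:
# `Extⁱ_R(C, R) = 0` for `1 ≤ i ≤ t` ⇒ `caᵗ⁺³(R) ⊆ 𝔠`; `Ext¹_R(C, R) = 0 ⇒ ca⁴(R) ⊆ 𝔠`; all `i` ⇒ `ca(R) ⊆ 𝔠`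

Route `ResolutionOfSingularities/HomologicalConductor`, chain W4.4b (cell `res-hironaka`), rung S-2
`PersistenceSurface` (stmt-ResolutionOfSingularities-19970), registered stub
`stub_levelFourPersistenceNonnormalOrNonrational'` (L-other′; class Σ8 = NON-NORMAL stage `0`), cell R5 / S-c.
Seat res-L1-w44b-stub-3 (gen 7) on res-L1-w44b-lead-1's WAVE 2 assignment (STATUS 18:52:55Z).  Composition of
p550697 (`…ConductorCeiling`: `𝔠 ≅ Hom_R(C, R)`, `caˢ⁺¹(R) ⊆ 𝔠` whenever `𝔠 ∈ Ωˢ`, level-free form) with the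
level lemma `…DualSyzygyLevel` (same seat: `Extⁱ_R(N, R) = 0` for `1 ≤ i ≤ t` ⇒ `N* ∈ Ωᵗ⁺²`).  `[OURS · L1 w44b]`;
folklore; NOT a statement of the manuscript under review (Hironaka 2017) and no statement of that manuscript is used;
AI-written, weaker than expert review.

Setting of p550697: `R` a noetherian domain with fraction field `K`, `C = M ⊆ K` an `R`-submodule with `1 ∈ M`,
closed under multiplication, finitely generated (a module-finite birational overring, e.g. the normalisation of a
non-normal surface stage), `𝔠 = (R : C)` its conductor handed over with `h𝔠`.

* `exists_isSyzygy_conductor_of_forall_ext_eq_zero` — `Extⁱ_R(C, R) = 0` for `1 ≤ i ≤ t` ⇒ `𝔠 ∈ Ωᵗ⁺²`.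
* **`cohomologyAnnihilatorOfDegree_le_conductor_of_forall_ext_eq_zero`** — then `caᵗ⁺³(R) ⊆ 𝔠`.
* **`cohomologyAnnihilatorOfDegree_four_le_conductor_of_forall_ext_one_eq_zero`** — first case:
  `Ext¹_R(C, R) = 0 ⇒ ca⁴(R) ⊆ 𝔠` (the level at which the door's C3′ is stated).
* `cohomologyAnnihilator_le_conductor_of_forall_ext_eq_zero` — `Extⁱ_R(C, R) = 0` for all `i ≥ 1` (e.g. `C` maximal
  Cohen–Macaulay over a Gorenstein `R`, on paper) ⇒ `ca(R) ⊆ 𝔠` at all levels.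

References (mechanism only): M. Auslander, M. Bridger, *Stable module theory* (1969), folklore form; S. B. Iyengar,
R. Takahashi, IMRN 2016, Remark 2.13 [`IyengarTakahashi2014`].
-/

-- single-problem summit: the doubled namespace component `ResolutionOfSingularities` is forced
set_option linter.dupNamespace false

noncomputable section

open CategoryTheory CategoryTheory.Abelian Literature.RingTheory.CohomologyAnnihilator
open scoped nonZeroDivisors
open Summit.ResolutionOfSingularities.ResolutionOfSingularities.Theorems.HomologicalConductor.PersistenceConductorCeiling
  (exists_linearEquiv_conductor_dual mem_conductor_of_mem_cohomologyAnnihilatorOfDegree_of_isSyzygy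
    cohomologyAnnihilator_le_conductor_of_forall_isSyzygy)
open Summit.ResolutionOfSingularities.ResolutionOfSingularities.Theorems.HomologicalConductor.PersistenceDualSyzygyLevel
  (exists_isSyzygy_dual_of_forall_ext_eq_zero exists_isSyzygy_dual_of_forall_ext_eq_zero')

universe u

namespace Summit.ResolutionOfSingularities.ResolutionOfSingularities.Theorems.HomologicalConductor.PersistenceConductorCeilingLevel

variable {R : Type u} [CommRing R] [IsDomain R] {K : Type u} [Field K] [Algebra R K] [IsFractionRing R K]

/-- **The conductor is a `(t+2)`-nd syzygy when `Extⁱ_R(C, R) = 0` for `1 ≤ i ≤ t`** (`𝔠 ≅ C*`, p550697, and the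
level lemma). [folklore] -/
theorem exists_isSyzygy_conductor_of_forall_ext_eq_zero [IsNoetherianRing R] (M : Submodule R K)
    (hM1 : (1 : K) ∈ M) (hMfg : M.FG) (𝔠 : Ideal R)
    (h𝔠 : ∀ r : R, r ∈ 𝔠 ↔ ∀ m ∈ M, ∃ r' : R, algebraMap R K r' = algebraMap R K r * m) {t : ℕ}
    (hExt : ∀ i : ℕ, 1 ≤ i → i ≤ t → ∀ e : Ext.{u} (ModuleCat.of R ↥M) (ModuleCat.of R R) i, e = 0) :
    ∃ (X : ModuleCat.{u} R), Module.Finite R X ∧ IsSyzygy (t + 2) X (ModuleCat.of R ↥𝔠) := by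
  haveI : Module.Finite R ↥M := Module.Finite.iff_fg.mpr hMfg
  obtain ⟨e⟩ := exists_linearEquiv_conductor_dual M hM1 𝔠 h𝔠
  obtain ⟨X, hX, h⟩ := exists_isSyzygy_dual_of_forall_ext_eq_zero t ↥M inferInstance hExt
  exact ⟨X, hX, h.of_iso e.symm.toModuleIso⟩

/-- **THE CONDUCTOR CEILING AT LEVEL `t + 3`: `Extⁱ_R(C, R) = 0` for `1 ≤ i ≤ t` ⇒ `caᵗ⁺³(R) ⊆ 𝔠`.**
[cite: IyengarTakahashi2014, Remark 2.13] -/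
theorem cohomologyAnnihilatorOfDegree_le_conductor_of_forall_ext_eq_zero [IsNoetherianRing R] (M : Submodule R K)
    (hM1 : (1 : K) ∈ M) (hMmul : ∀ a ∈ M, ∀ b ∈ M, a * b ∈ M) (hMfg : M.FG) (𝔠 : Ideal R)
    (h𝔠 : ∀ r : R, r ∈ 𝔠 ↔ ∀ m ∈ M, ∃ r' : R, algebraMap R K r' = algebraMap R K r * m) {t : ℕ}
    (hExt : ∀ i : ℕ, 1 ≤ i → i ≤ t → ∀ e : Ext.{u} (ModuleCat.of R ↥M) (ModuleCat.of R R) i, e = 0) :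
    cohomologyAnnihilatorOfDegree R (t + 3) ≤ 𝔠 := by
  intro x hx
  obtain ⟨X, hX, hsyz⟩ := exists_isSyzygy_conductor_of_forall_ext_eq_zero M hM1 hMfg 𝔠 h𝔠 hExt
  haveI := hX
  exact mem_conductor_of_mem_cohomologyAnnihilatorOfDegree_of_isSyzygy M hMmul hMfg 𝔠 h𝔠 (s := t + 2) hx hsyz

/-- **First case: `Ext¹_R(C, R) = 0 ⇒ ca⁴(R) ⊆ 𝔠`** — the level-`4` conductor ceiling under one `Ext` vanishing (the
level at which the rung's door C3′ `LevelFourPersistenceNonnormalOrNonrational'` is stated).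
[cite: IyengarTakahashi2014, Remark 2.13] -/
theorem cohomologyAnnihilatorOfDegree_four_le_conductor_of_forall_ext_one_eq_zero [IsNoetherianRing R]
    (M : Submodule R K) (hM1 : (1 : K) ∈ M) (hMmul : ∀ a ∈ M, ∀ b ∈ M, a * b ∈ M) (hMfg : M.FG) (𝔠 : Ideal R)
    (h𝔠 : ∀ r : R, r ∈ 𝔠 ↔ ∀ m ∈ M, ∃ r' : R, algebraMap R K r' = algebraMap R K r * m)
    (h1 : ∀ e : Ext.{u} (ModuleCat.of R ↥M) (ModuleCat.of R R) 1, e = 0) :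
    cohomologyAnnihilatorOfDegree R 4 ≤ 𝔠 :=
  cohomologyAnnihilatorOfDegree_le_conductor_of_forall_ext_eq_zero M hM1 hMmul hMfg 𝔠 h𝔠 (t := 1)
    fun i hi hi1 e => by
      obtain rfl : i = 1 := le_antisymm hi1 hi
      exact h1 e

/-- **All levels: `Extⁱ_R(C, R) = 0` for every `i ≥ 1` ⇒ `ca(R) ⊆ 𝔠`** (p550697's level-free form fed by the level
lemma; e.g. `C` maximal Cohen–Macaulay over a Gorenstein `R`, on paper). [cite: IyengarTakahashi2014, Remark 2.13] -/
theorem cohomologyAnnihilator_le_conductor_of_forall_ext_eq_zero [IsNoetherianRing R] (M : Submodule R K)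
    (hM1 : (1 : K) ∈ M) (hMmul : ∀ a ∈ M, ∀ b ∈ M, a * b ∈ M) (hMfg : M.FG) (𝔠 : Ideal R)
    (h𝔠 : ∀ r : R, r ∈ 𝔠 ↔ ∀ m ∈ M, ∃ r' : R, algebraMap R K r' = algebraMap R K r * m)
    (h : ∀ i : ℕ, 1 ≤ i → ∀ e : Ext.{u} (ModuleCat.of R ↥M) (ModuleCat.of R R) i, e = 0) :
    cohomologyAnnihilator R ≤ 𝔠 := by
  haveI : Module.Finite R ↥M := Module.Finite.iff_fg.mpr hMfg
  obtain ⟨e⟩ := exists_linearEquiv_conductor_dual M hM1 𝔠 h𝔠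
  refine cohomologyAnnihilator_le_conductor_of_forall_isSyzygy M hMmul hMfg 𝔠 h𝔠 ⟨0, fun s _ => ?_⟩
  obtain ⟨X, hX, hs⟩ := exists_isSyzygy_dual_of_forall_ext_eq_zero' ↥M h s
  exact ⟨X, hX, hs.of_iso e.symm.toModuleIso⟩

/-! ## Appendix (same seat, same day): the route's vocabulary — subalgebras `B ≤ C` of a field -/

/-- **Conductor ceiling at level `t + 3` for subalgebras** `B ≤ C` of a field `K` with `Frac B = K` and `C`
contained in a finitely generated `B`-submodule of itself: if `Extⁱ_B(C, B) = 0` for `1 ≤ i ≤ t` (with `C` taken as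
the `B`-submodule `span_B C` of `K`, whose carrier is `C`), then every `x ∈ caᵗ⁺³(B)` multiplies `C` into `B`.  The case
`t = 0` is p550697's `Subalgebra.coe_mul_mem_of_mem_cohomologyAnnihilatorOfDegree_three` (same packaging).
[cite: IyengarTakahashi2014, Remark 2.13] -/
theorem Subalgebra.coe_mul_mem_of_mem_cohomologyAnnihilatorOfDegree_of_forall_ext_eq_zero {k : Type u} [Field k]
    [Algebra k K] (B C : Subalgebra k K) (hBC : B ≤ C) [IsFractionRing ↥B K] [IsNoetherianRing ↥B]
    (hfin : ∃ s : Finset K, (↑s : Set K) ⊆ (C : Set K) ∧ (C : Set K) ⊆ Submodule.span ↥B (↑s : Set K)) {t : ℕ}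
    (hExt : ∀ i : ℕ, 1 ≤ i → i ≤ t →
      ∀ e : Ext.{u} (ModuleCat.of ↥B ↥(Submodule.span ↥B (C : Set K))) (ModuleCat.of ↥B ↥B) i, e = 0)
    {x : ↥B} (hx : x ∈ cohomologyAnnihilatorOfDegree ↥B (t + 3)) {γ : K} (hγ : γ ∈ C) :
    (x : K) * γ ∈ B := by
  classical
  -- `C` as a `B`-submodule of `K` (same packaging as p550697's subalgebra ceiling)
  let M : Submodule ↥B K := Submodule.span ↥B (C : Set K)
  have hCM : ∀ {y : K}, y ∈ M ↔ y ∈ C := by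
    intro y
    constructor
    · intro hy
      refine Submodule.span_induction (p := fun y _ => y ∈ C) (fun z hz => hz) C.zero_mem
        (fun a b _ _ ha hb => C.add_mem ha hb) (fun b a _ ha => ?_) hy
      rw [Algebra.smul_def]
      exact C.mul_mem (hBC b.2) ha
    · exact fun hy => Submodule.subset_span hy
  have hM1 : (1 : K) ∈ M := hCM.mpr C.one_mem
  have hMmul : ∀ a ∈ M, ∀ b ∈ M, a * b ∈ M := fun a ha b hb =>
    hCM.mpr (C.mul_mem (hCM.mp ha) (hCM.mp hb))
  have hMfg : M.FG := by
    obtain ⟨s, hsC, hCs⟩ := hfin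
    refine ⟨s, le_antisymm (Submodule.span_mono hsC) ?_⟩
    exact Submodule.span_le.mpr hCs
  -- the conductor ideal
  let 𝔠 : Ideal ↥B :=
    { carrier := {r | ∀ m ∈ M, ∃ r' : ↥B, algebraMap (↥B) K r' = algebraMap (↥B) K r * m}
      add_mem' := fun {a b} ha hb m hm => by
        obtain ⟨a', ha'⟩ := ha m hm
        obtain ⟨b', hb'⟩ := hb m hm
        exact ⟨a' + b', by rw [map_add, ha', hb', map_add, add_mul]⟩
      zero_mem' := fun m _ => ⟨0, by simp⟩
      smul_mem' := fun c {a} ha m hm => by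
        obtain ⟨a', ha'⟩ := ha m hm
        exact ⟨c * a', by rw [map_mul, ha', smul_eq_mul, map_mul, mul_assoc]⟩ }
  have h𝔠 : ∀ r : ↥B, r ∈ 𝔠 ↔ ∀ m ∈ M, ∃ r' : ↥B, algebraMap (↥B) K r' = algebraMap (↥B) K r * m :=
    fun r => Iff.rfl
  have hx𝔠 : x ∈ 𝔠 :=
    cohomologyAnnihilatorOfDegree_le_conductor_of_forall_ext_eq_zero M hM1 hMmul hMfg 𝔠 h𝔠 hExt hx
  obtain ⟨r', hr'⟩ := (h𝔠 x).mp hx𝔠 γ (hCM.mpr hγ)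
  change (r' : K) = (x : K) * γ at hr'
  rw [← hr']
  exact r'.2

end Summit.ResolutionOfSingularities.ResolutionOfSingularities.Theorems.HomologicalConductor.PersistenceConductorCeilingLevel

end
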